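import Summits.HodgeConjecture.CorCM.MultiFieldWeilGaloisHypotheses
import Summits.HodgeConjecture.CorCM.MultiFieldWeilMarkmanTowers
import Summits.HodgeConjecture.CorCM.MultiFieldWeilJointPrimesHodge
import Summits.HodgeConjecture.CorCM.MultiFieldWeilMixedTower
import Summits.HodgeConjecture.CorCM.SexticOcticWeilHodgeOfMarkman
import HarnessLib

/-!
# MULTI-FIELD WEIL ENGINE — THE MARKMAN-ONLY HEADLINES WITH NUMBER-FIELD HYPOTHESES: sextic ∕ decic towers, jointly independent sextics ∕ decics,
# the 2-transitive tower and the mixed tower, with `hH` ∕ `hJ` ∕ `h2T` replaced by Galois-closure non-containment and degrees of ONE compositum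

Cell `pub-hodgecm2` (COR-CM), seat b30 gen 31 (2026-08-24); count-neutral own lane MULTI-FIELD WEIL ENGINE (stem `MultiFieldWeil*`), sequel of
`CorCM/MultiFieldWeilGaloisHypotheses.lean` (the adapters) applied BY NAME to the headlines of `CorCM/MultiFieldWeilMarkmanTowers.lean` (T5),
`CorCM/MultiFieldWeilJointPrimesHodge.lean` (T7), `CorCM/MultiFieldWeilTwoTransitiveTower.lean` (T11) and `CorCM/MultiFieldWeilMixedTower.lean` (T13).  Theorems only;
no definition, no named fact, no `sorry`.  HONEST FRAMING: every statement is conditional on the displayed Markman binders (`hW4` fourfold, `hM6` hyperbolic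
sixfold) exactly as its parent and on NOTHING else; `HC_CM` is NOT proved and not asserted.

Setting: `k = Kf i₀` imaginary quadratic with a complex embedding `τ`, `E = A 0 ⊨ (k; {τ})`; CM fields `K_m = Kf (is m) ⊇ im m (k)` (`m : Fin r`) realised by
`B_m = A (m+1) ⊨ (K_m; Φ (m+1))` with `p_m` members of `Φ (m+1)` over `τ`; `L(K) = normalClosure ℚ K ℂ` the Galois closure in `ℂ`; `n_m = [K_m : k]`.  In every
headline the conclusion is the Hodge conjecture for EVERY product of copies `⨁_j A (κ j)`.

* §1 (T5, `hH` ⟸ Galois closures) **`hodgeConjectureFor_biproduct_comp_of_sexticDecicTower_galois`** — sextic `(1,2)` and decic `(2,3)` fields under a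
  priority: each field with an equal-degree predecessor has a `τ`-embedding taking a value OUTSIDE `L(k) · ∏ L(K_m)` (product over its equal-degree
  predecessors); **`…_of_sexticTower_galois`**, **`…_of_decicTower_galois`** (predecessors = earlier indices).  For two cubic extensions of `k` this says:
  `K₁` is not `k`-isomorphic to a subfield of the Galois closure of `K₀` over `k`.
* §2 (T7, `hJ` ⟸ one degree) **`hodgeConjectureFor_biproduct_comp_of_sextics_of_finrank`** — ANY number of sextic `(1,2)` fields: ONE family `(s₀_m)_m` of
  `τ`-embeddings with `[ℚ(τk, s₀_0(K_0), …, s₀_{r−1}(K_{r−1})) : ℚ] = 2 · 3^r` (the `K_m` linearly disjoint over `k`); **`…_of_decics_of_finrank`** (`2 · 5^r`);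
  **`…_of_sexticsDecics_of_finrank`** (per degree class).
* §3 (T11, `h2T` ⟸ one degree `n(n−1)`) **`hodgeConjectureFor_biproduct_comp_of_twoTransitiveTower_markman_of_finrank`** — sextic ∕ octic (`(1,3)` or `(2,2)`) ∕
  decic fields in order, each `K_{m₀}` having a pair `s ≠ t` of `τ`-embeddings with `[L_{<m₀} · s(K_{m₀}) · t(K_{m₀}) : L_{<m₀}] = n_{m₀}(n_{m₀} − 1)`,
  `L_{<m₀} = L(k) · ∏_{m<m₀} L(K_m)`.
* §4 (T13) **`hodgeConjectureFor_biproduct_comp_of_mixedTower_markman_of_finrank`** — THE ROOF with the `2`-transitive branch in degree form.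

[cite: Markman2025SurveySecant, Thm. 1.2] [cite: Lang2002, VI §1 Thm. 1.1, Cor. 1.6 and V §2 Thm. 2.8] [cite: Shimura1998, §18.2 Lemma (i)]
[cite: MoonenZarhin1995Duke, Thm. 2.4] [cite: DixonMortimer1996, §1.6]

## References
* [Markman2025SurveySecant] E. Markman, survey of the secant-sheaf construction, Thm. 1.2 (Weil classes on abelian fourfolds ∕ hyperbolic sixfolds).
  [Lang2002] S. Lang, *Algebra*, GTM 211, V §2 Thm. 2.8, VI §1 Thm. 1.1, Cor. 1.6.  [Shimura1998] G. Shimura, *Abelian varieties with complex multiplication and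
  modular functions*, §18.2 Lemma (i).  [MoonenZarhin1995Duke] B. Moonen, Yu. Zarhin, Duke Math. J. 77 (1995), Thm. 2.4.  [DixonMortimer1996] J. D. Dixon,
  B. Mortimer, *Permutation Groups*, GTM 163, §1.6.
-/

noncomputable section

open CategoryTheory CategoryTheory.Limits NumberField IntermediateField

namespace Summit.HodgeConjecture.CorCM.MultiFieldWeil

open Finset
open Literature.AlgebraicGeometry Literature.AlgebraicGeometry.Motives Literature.AlgebraicGeometry.HodgeTheory
open Literature.AlgebraicGeometry.ComplexMultiplication (IsCMTypeRealisation)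
open Literature.AlgebraicTopology.SingularHomology
open Literature.NumberTheory.ComplexMultiplication

open scoped Classical

variable {I : Type} {r : ℕ} {Kf : I → Type} [∀ i, Field (Kf i)] [∀ i, NumberField (Kf i)] [∀ i, IsCMField (Kf i)]
  {i₀ : I} {is : Fin r → I} {τ : Kf i₀ →+* ℂ}
  {A : Fin (r + 1) → AbelianVariety ℂ} {Φ : ∀ j : Fin (r + 1), CMType (Kf (mfSlots i₀ is j))}
  {ι : ∀ j, 𝓞 (Kf (mfSlots i₀ is j)) →+* End (A j)}
  {θ : ∀ j, Kf (mfSlots i₀ is j) →+* Module.End ℂ (complexBetti (A j).X 1)}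

/-! ## §1 Sextic ∕ decic towers: `hH` from Galois closures -/

/-- **SEXTIC `(1,2)` AND DECIC `(2,3)` FIELDS UNDER A PRIORITY, `hH` IN GALOIS FORM — given only Markman's two theorems.**  As
`hodgeConjectureFor_biproduct_comp_of_sexticDecicTower`, with the automorphism hypothesis replaced by: every `K_{m₀}` having an equal-degree predecessor has a
`τ`-embedding `s` and an element `a` with `s a ∉ L(k) ⊔ ⨆ L(K_m)` (`m` over the equal-degree predecessors; `L = normalClosure ℚ · ℂ`).  Then the Hodge
conjecture holds for every product of copies `⨁_j A (κ j)`.  `HC_CM` is NOT asserted. [cite: Markman2025SurveySecant, Thm. 1.2]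
[cite: Lang2002, VI §1 Thm. 1.1, Cor. 1.6 and V §2 Thm. 2.8] -/
theorem hodgeConjectureFor_biproduct_comp_of_sexticDecicTower_galois (hW4 : Markman2025_weilClasses_algebraic_abelianFourfold)
    (hM6 : Markman2025_weilClasses_algebraic_hyperbolicSixfold) (n p prio : Fin r → ℕ)
    (hnp : ∀ m, (n m = 3 ∧ p m = 1) ∨ (n m = 5 ∧ p m = 2)) (hinj : Function.Injective prio) (hmono : ∀ m m', n m < n m' → prio m < prio m')
    {N : ℕ} (κ : Fin N → Fin (r + 1)) (h2 : Module.finrank ℚ (Kf i₀) = 2) (hdeg : ∀ m : Fin r, Module.finrank ℚ (Kf (is m)) = 2 * n m)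
    (im : ∀ m : Fin r, Kf i₀ →+* Kf (is m)) (hA : ∀ j, IsCMTypeRealisation (Φ j) (A j) (ι j) (θ j)) (hΨ : ∀ σ : Kf i₀ →+* ℂ, σ ∈ (Φ 0).1 ↔ σ = τ)
    (hp : ∀ m : Fin r, (Finset.univ.filter fun s : Kf (is m) →+* ℂ => s.comp (im m) = τ ∧ s ∈ (Φ m.succ).1).card = p m)
    (hG : ∀ m₀ : Fin r, (∃ m, m ≠ m₀ ∧ n m = n m₀ ∧ prio m < prio m₀) →
      ∃ s : Kf (is m₀) →+* ℂ, s.comp (im m₀) = τ ∧ ∃ a : Kf (is m₀),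
        s a ∉ normalClosure ℚ (Kf i₀) ℂ ⊔ ⨆ m : {m : Fin r // n m = n m₀ ∧ prio m < prio m₀}, normalClosure ℚ (Kf (is m.1)) ℂ) :
    HodgeConjectureFor (⨁ fun j => A (κ j)).dim (⨁ fun j => A (κ j)).X :=
  hodgeConjectureFor_biproduct_comp_of_sexticDecicTower hW4 hM6 n p prio hnp hinj hmono κ h2 hdeg im hA hΨ hp fun m₀ hex => by
    obtain ⟨s, hs, a, ha⟩ := hG m₀ hex
    obtain ⟨ρ, hρτ, hfix, hmove⟩ := exists_over_fix_move_of_apply_not_mem im (fun m => n m = n m₀ ∧ prio m < prio m₀) m₀ s hs a ha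
    exact ⟨ρ, hρτ, fun m hn' hp' => hfix m ⟨hn', hp'⟩, hmove⟩

/-- **ANY NUMBER OF `(1,2)`-THREEFOLDS OVER SEXTIC CM FIELDS SHARING `k`, `hH` IN GALOIS FORM — given ONLY Markman's fourfold theorem.**  As
`hodgeConjectureFor_biproduct_comp_of_sexticTower`, with the automorphism hypothesis replaced by: every `K_{m₀}` with `m₀ > 0` has a `τ`-embedding taking a
value outside `L(k) ⊔ ⨆_{m < m₀} L(K_m)` (for TWO fields: some `τ`-embedding of `K₁` does not land in the Galois closure of `K₀` in `ℂ`; for cubic extensions of `k`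
this holds as soon as `Hom(K₁, K₀) = ∅`, the cubic subfields of the closure being the conjugates of `K₀` — that case is made hypothesis-free in
`CorCM/MultiFieldWeilNonIsomorphicSextics.lean` by a different route).  `HC_CM` is NOT asserted. [cite: Markman2025SurveySecant, Thm. 1.2]
[cite: Lang2002, VI §1 Thm. 1.1, Cor. 1.6 and V §2 Thm. 2.8] -/
theorem hodgeConjectureFor_biproduct_comp_of_sexticTower_galois (hW4 : Markman2025_weilClasses_algebraic_abelianFourfold)
    {N : ℕ} (κ : Fin N → Fin (r + 1)) (h2 : Module.finrank ℚ (Kf i₀) = 2) (h6 : ∀ m : Fin r, Module.finrank ℚ (Kf (is m)) = 6)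
    (im : ∀ m : Fin r, Kf i₀ →+* Kf (is m)) (hA : ∀ j, IsCMTypeRealisation (Φ j) (A j) (ι j) (θ j)) (hΨ : ∀ σ : Kf i₀ →+* ℂ, σ ∈ (Φ 0).1 ↔ σ = τ)
    (h1 : ∀ m : Fin r, (Finset.univ.filter fun s : Kf (is m) →+* ℂ => s.comp (im m) = τ ∧ s ∈ (Φ m.succ).1).card = 1)
    (hG : ∀ m₀ : Fin r, (∃ m, m < m₀) → ∃ s : Kf (is m₀) →+* ℂ, s.comp (im m₀) = τ ∧ ∃ a : Kf (is m₀),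
      s a ∉ normalClosure ℚ (Kf i₀) ℂ ⊔ ⨆ m : {m : Fin r // m < m₀}, normalClosure ℚ (Kf (is m.1)) ℂ) :
    HodgeConjectureFor (⨁ fun j => A (κ j)).dim (⨁ fun j => A (κ j)).X :=
  hodgeConjectureFor_biproduct_comp_of_sexticTower hW4 κ h2 h6 im hA hΨ h1 fun m₀ hex => by
    obtain ⟨s, hs, a, ha⟩ := hG m₀ hex
    exact exists_over_fix_move_of_apply_not_mem im (fun m => m < m₀) m₀ s hs a ha

/-- **ANY NUMBER OF `(2,3)`-FIVEFOLDS OVER DECIC CM FIELDS SHARING `k`, `hH` IN GALOIS FORM — given ONLY Markman's hyperbolic-sixfold theorem.**  As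
`hodgeConjectureFor_biproduct_comp_of_decicTower` with the automorphism hypothesis replaced by the Galois-closure non-containment.  `HC_CM` is NOT asserted.
[cite: Markman2025SurveySecant, Thm. 1.2] [cite: Lang2002, VI §1 Thm. 1.1, Cor. 1.6 and V §2 Thm. 2.8] -/
theorem hodgeConjectureFor_biproduct_comp_of_decicTower_galois (hM6 : Markman2025_weilClasses_algebraic_hyperbolicSixfold)
    {N : ℕ} (κ : Fin N → Fin (r + 1)) (h2 : Module.finrank ℚ (Kf i₀) = 2) (h10 : ∀ m : Fin r, Module.finrank ℚ (Kf (is m)) = 10)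
    (im : ∀ m : Fin r, Kf i₀ →+* Kf (is m)) (hA : ∀ j, IsCMTypeRealisation (Φ j) (A j) (ι j) (θ j)) (hΨ : ∀ σ : Kf i₀ →+* ℂ, σ ∈ (Φ 0).1 ↔ σ = τ)
    (h23 : ∀ m : Fin r, (Finset.univ.filter fun s : Kf (is m) →+* ℂ => s.comp (im m) = τ ∧ s ∈ (Φ m.succ).1).card = 2)
    (hG : ∀ m₀ : Fin r, (∃ m, m < m₀) → ∃ s : Kf (is m₀) →+* ℂ, s.comp (im m₀) = τ ∧ ∃ a : Kf (is m₀),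
      s a ∉ normalClosure ℚ (Kf i₀) ℂ ⊔ ⨆ m : {m : Fin r // m < m₀}, normalClosure ℚ (Kf (is m.1)) ℂ) :
    HodgeConjectureFor (⨁ fun j => A (κ j)).dim (⨁ fun j => A (κ j)).X :=
  hodgeConjectureFor_biproduct_comp_of_decicTower hM6 κ h2 h10 im hA hΨ h23 fun m₀ hex => by
    obtain ⟨s, hs, a, ha⟩ := hG m₀ hex
    exact exists_over_fix_move_of_apply_not_mem im (fun m => m < m₀) m₀ s hs a ha

/-! ## §2 Jointly independent sextics ∕ decics: `hJ` from the degree of one compositum -/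

/-- The product of a constant over `Fin r` (bookkeeping). [folklore] -/
theorem prod_const_fin (c : ℕ) : ∏ _m : Fin r, c = c ^ r := by
  rw [Finset.prod_const, Finset.card_univ, Fintype.card_fin]

/-- **ANY NUMBER OF `(1,2)`-THREEFOLDS OVER SEXTIC CM FIELDS, LINEARLY DISJOINT OVER `k` — given ONLY Markman's fourfold theorem.**  As
`hodgeConjectureFor_biproduct_comp_of_sextics`, with the joint-transitivity hypothesis `hJ` replaced by: ONE family `(s₀_m)_m` of `τ`-embeddings whose images
generate with `τ(k)` a subfield of `ℂ` of degree `2 · 3^r` over `ℚ` (i.e. `[s₀_0(K_0) ⋯ s₀_{r−1}(K_{r−1}) : τk] = 3^r`: the cubic extensions `K_m/k` are linearly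
disjoint).  Then the Hodge conjecture holds for every product of copies `⨁_j A (κ j)`.  `HC_CM` is NOT asserted. [cite: Markman2025SurveySecant, Thm. 1.2]
[cite: Lang2002, VI §1 Thm. 1.1, Cor. 1.6 and V §2 Thm. 2.8] [cite: Shimura1998, §18.2 Lemma (i)] -/
theorem hodgeConjectureFor_biproduct_comp_of_sextics_of_finrank (hW4 : Markman2025_weilClasses_algebraic_abelianFourfold)
    {N : ℕ} (κ : Fin N → Fin (r + 1)) (h2 : Module.finrank ℚ (Kf i₀) = 2) (h6 : ∀ m : Fin r, Module.finrank ℚ (Kf (is m)) = 6)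
    (im : ∀ m : Fin r, Kf i₀ →+* Kf (is m)) (hA : ∀ j, IsCMTypeRealisation (Φ j) (A j) (ι j) (θ j)) (hΨ : ∀ σ : Kf i₀ →+* ℂ, σ ∈ (Φ 0).1 ↔ σ = τ)
    (h1 : ∀ m : Fin r, (Finset.univ.filter fun s : Kf (is m) →+* ℂ => s.comp (im m) = τ ∧ s ∈ (Φ m.succ).1).card = 1)
    (s₀ : ∀ m : Fin r, Kf (is m) →+* ℂ) (hs₀ : ∀ m, (s₀ m).comp (im m) = τ)
    (hdeg₀ : Module.finrank ℚ ↥(adjoin ℚ (Set.range τ) ⊔ adjoin ℚ (⋃ m, Set.range (s₀ m))) = 2 * 3 ^ r) :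
    HodgeConjectureFor (⨁ fun j => A (κ j)).dim (⨁ fun j => A (κ j)).X := by
  refine hodgeConjectureFor_biproduct_comp_of_sextics hW4 κ h2 h6 im hA hΨ h1 fun s s' hss' => ?_
  haveI : FiniteDimensional ℚ ↥(adjoin ℚ (Set.range τ)) :=
    Module.finite_of_finrank_pos (by rw [finrank_adjoin_range_ringHom]; exact Module.finrank_pos)
  have hdeg' : Module.finrank ℚ ↥(adjoin ℚ (Set.range τ) ⊔ adjoin ℚ (⋃ m, Set.range (s₀ m))) =
      Module.finrank ℚ ↥(adjoin ℚ (Set.range τ)) * ∏ _m : Fin r, 3 := by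
    rw [hdeg₀, finrank_adjoin_range_ringHom, h2, prod_const_fin]
  obtain ⟨ρ, -, hρ⟩ := exists_ringEquiv_fix_comp_eq_comp_of_finrank (i := im) (adjoin ℚ (Set.range τ)) (fun x => subset_adjoin ℚ _ ⟨x, rfl⟩) s₀ hs₀
    (fun _ => 3) (fun m => SexticOcticWeil.card_filter_comp_eq_of_finrank (im m) (by rw [h6 m]) h2 τ) hdeg' s s' (fun m => (hss' m).1) (fun m => (hss' m).2)
  exact ⟨ρ, hρ⟩

/-- **ANY NUMBER OF `(2,3)`-FIVEFOLDS OVER DECIC CM FIELDS, LINEARLY DISJOINT OVER `k` — given ONLY Markman's hyperbolic-sixfold theorem.**  As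
`hodgeConjectureFor_biproduct_comp_of_decics`, with `hJ` replaced by ONE family of `τ`-embeddings generating with `τ(k)` a subfield of degree `2 · 5^r`.
`HC_CM` is NOT asserted. [cite: Markman2025SurveySecant, Thm. 1.2] [cite: Lang2002, VI §1 Thm. 1.1, Cor. 1.6 and V §2 Thm. 2.8] -/
theorem hodgeConjectureFor_biproduct_comp_of_decics_of_finrank (hM6 : Markman2025_weilClasses_algebraic_hyperbolicSixfold)
    {N : ℕ} (κ : Fin N → Fin (r + 1)) (h2 : Module.finrank ℚ (Kf i₀) = 2) (h10 : ∀ m : Fin r, Module.finrank ℚ (Kf (is m)) = 10)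
    (im : ∀ m : Fin r, Kf i₀ →+* Kf (is m)) (hA : ∀ j, IsCMTypeRealisation (Φ j) (A j) (ι j) (θ j)) (hΨ : ∀ σ : Kf i₀ →+* ℂ, σ ∈ (Φ 0).1 ↔ σ = τ)
    (h23 : ∀ m : Fin r, (Finset.univ.filter fun s : Kf (is m) →+* ℂ => s.comp (im m) = τ ∧ s ∈ (Φ m.succ).1).card = 2)
    (s₀ : ∀ m : Fin r, Kf (is m) →+* ℂ) (hs₀ : ∀ m, (s₀ m).comp (im m) = τ)
    (hdeg₀ : Module.finrank ℚ ↥(adjoin ℚ (Set.range τ) ⊔ adjoin ℚ (⋃ m, Set.range (s₀ m))) = 2 * 5 ^ r) :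
    HodgeConjectureFor (⨁ fun j => A (κ j)).dim (⨁ fun j => A (κ j)).X := by
  refine hodgeConjectureFor_biproduct_comp_of_decics hM6 κ h2 h10 im hA hΨ h23 fun s s' hss' => ?_
  haveI : FiniteDimensional ℚ ↥(adjoin ℚ (Set.range τ)) :=
    Module.finite_of_finrank_pos (by rw [finrank_adjoin_range_ringHom]; exact Module.finrank_pos)
  have hdeg' : Module.finrank ℚ ↥(adjoin ℚ (Set.range τ) ⊔ adjoin ℚ (⋃ m, Set.range (s₀ m))) =
      Module.finrank ℚ ↥(adjoin ℚ (Set.range τ)) * ∏ _m : Fin r, 5 := by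
    rw [hdeg₀, finrank_adjoin_range_ringHom, h2, prod_const_fin]
  obtain ⟨ρ, -, hρ⟩ := exists_ringEquiv_fix_comp_eq_comp_of_finrank (i := im) (adjoin ℚ (Set.range τ)) (fun x => subset_adjoin ℚ _ ⟨x, rfl⟩) s₀ hs₀
    (fun _ => 5) (fun m => SexticOcticWeil.card_filter_comp_eq_of_finrank (im m) (by rw [h10 m]) h2 τ) hdeg' s s' (fun m => (hss' m).1)
    (fun m => (hss' m).2)
  exact ⟨ρ, hρ⟩

/-- **SEXTIC AND DECIC FIELDS TOGETHER, EACH DEGREE CLASS LINEARLY DISJOINT OVER `k` — given only Markman's two theorems.**  As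
`hodgeConjectureFor_biproduct_comp_of_sexticsDecics`, with `hJ` replaced by: for each degree class `{m | n m = n m₀}` with at least two members, ONE family `s₀`
of `τ`-embeddings of its fields generating with `τ(k)` a subfield of `ℂ` of degree `2 · ∏_{n m = n m₀} n m`.  `HC_CM` is NOT asserted.
[cite: Markman2025SurveySecant, Thm. 1.2] [cite: Lang2002, VI §1 Thm. 1.1, Cor. 1.6 and V §2 Thm. 2.8] -/
theorem hodgeConjectureFor_biproduct_comp_of_sexticsDecics_of_finrank (hW4 : Markman2025_weilClasses_algebraic_abelianFourfold)
    (hM6 : Markman2025_weilClasses_algebraic_hyperbolicSixfold) (n p : Fin r → ℕ) (hnp : ∀ m, (n m = 3 ∧ p m = 1) ∨ (n m = 5 ∧ p m = 2))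
    {N : ℕ} (κ : Fin N → Fin (r + 1)) (h2 : Module.finrank ℚ (Kf i₀) = 2) (hdeg : ∀ m : Fin r, Module.finrank ℚ (Kf (is m)) = 2 * n m)
    (im : ∀ m : Fin r, Kf i₀ →+* Kf (is m)) (hA : ∀ j, IsCMTypeRealisation (Φ j) (A j) (ι j) (θ j)) (hΨ : ∀ σ : Kf i₀ →+* ℂ, σ ∈ (Φ 0).1 ↔ σ = τ)
    (hp : ∀ m : Fin r, (Finset.univ.filter fun s : Kf (is m) →+* ℂ => s.comp (im m) = τ ∧ s ∈ (Φ m.succ).1).card = p m)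
    (hD : ∀ m₀ : Fin r, (∃ m, m ≠ m₀ ∧ n m = n m₀) → ∃ s₀ : ∀ m : Fin r, Kf (is m) →+* ℂ, (∀ m, n m = n m₀ → (s₀ m).comp (im m) = τ) ∧
      Module.finrank ℚ ↥(adjoin ℚ (Set.range τ) ⊔ adjoin ℚ (⋃ (m : Fin r) (_ : n m = n m₀), Set.range (s₀ m))) =
        2 * ∏ m ∈ Finset.univ.filter (fun m => n m = n m₀), n m) :
    HodgeConjectureFor (⨁ fun j => A (κ j)).dim (⨁ fun j => A (κ j)).X := by
  refine hodgeConjectureFor_biproduct_comp_of_sexticsDecics hW4 hM6 n p hnp κ h2 hdeg im hA hΨ hp fun m₀ hex s s' hss' => ?_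
  obtain ⟨s₀, hs₀, hd⟩ := hD m₀ hex
  exact jointTransitive_of_finrank im (fun m => n m = n m₀) n (fun m _ => SexticOcticWeil.card_filter_comp_eq_of_finrank (im m) (hdeg m) h2 τ) s₀ hs₀
    (by rw [h2]; exact hd) s s' hss'

/-! ## §3 The 2-transitive tower: `h2T` from one degree `n(n−1)` -/

/-- **THE 2-TRANSITIVE TOWER IN DEGREE FORM — sextic `(1,2)`, octic `(1,3)` ∕ `(2,2)`, decic `(2,3)` fields, given ONLY Markman's two theorems.**  As
`hodgeConjectureFor_biproduct_comp_of_twoTransitiveTower_markman`, with the relative 2-transitivity `h2T` replaced by: every `K_{m₀}` has a pair `s₀ ≠ t₀` of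
`τ`-embeddings with `[L_{<m₀} ⊔ ℚ(s₀(K_{m₀}) ∪ t₀(K_{m₀})) : ℚ] = [L_{<m₀} : ℚ] · n_{m₀}(n_{m₀} − 1)`, where `L_{<m₀} = L(k) ⊔ ⨆_{m < m₀} L(K_m)` is the compositum
in `ℂ` of the Galois closures of `k` and of the earlier fields.  Then the Hodge conjecture holds for every product of copies `⨁_j A (κ j)`.  `HC_CM` is NOT
asserted. [cite: Markman2025SurveySecant, Thm. 1.2] [cite: Lang2002, VI §1 Thm. 1.1, Cor. 1.6 and V §2 Thm. 2.8] [cite: DixonMortimer1996, §1.6] -/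
theorem hodgeConjectureFor_biproduct_comp_of_twoTransitiveTower_markman_of_finrank (hW4 : Markman2025_weilClasses_algebraic_abelianFourfold)
    (hM6 : Markman2025_weilClasses_algebraic_hyperbolicSixfold) (n p : Fin r → ℕ)
    (hnp : ∀ m, (n m = 3 ∧ p m = 1) ∨ (n m = 4 ∧ p m = 1) ∨ (n m = 4 ∧ p m = 2) ∨ (n m = 5 ∧ p m = 2))
    {N : ℕ} (κ : Fin N → Fin (r + 1)) (h2 : Module.finrank ℚ (Kf i₀) = 2) (hdeg : ∀ m : Fin r, Module.finrank ℚ (Kf (is m)) = 2 * n m)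
    (im : ∀ m : Fin r, Kf i₀ →+* Kf (is m)) (hA : ∀ j, IsCMTypeRealisation (Φ j) (A j) (ι j) (θ j)) (hΨ : ∀ σ : Kf i₀ →+* ℂ, σ ∈ (Φ 0).1 ↔ σ = τ)
    (hp : ∀ m : Fin r, (Finset.univ.filter fun s : Kf (is m) →+* ℂ => s.comp (im m) = τ ∧ s ∈ (Φ m.succ).1).card = p m)
    (hD : ∀ m₀ : Fin r, ∃ s₀ t₀ : Kf (is m₀) →+* ℂ, s₀.comp (im m₀) = τ ∧ t₀.comp (im m₀) = τ ∧ s₀ ≠ t₀ ∧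
      Module.finrank ℚ ↥((normalClosure ℚ (Kf i₀) ℂ ⊔ ⨆ m : {m : Fin r // m < m₀}, normalClosure ℚ (Kf (is m.1)) ℂ) ⊔
          adjoin ℚ (Set.range s₀ ∪ Set.range t₀)) =
        Module.finrank ℚ ↥(normalClosure ℚ (Kf i₀) ℂ ⊔ ⨆ m : {m : Fin r // m < m₀}, normalClosure ℚ (Kf (is m.1)) ℂ) * (n m₀ * (n m₀ - 1))) :
    HodgeConjectureFor (⨁ fun j => A (κ j)).dim (⨁ fun j => A (κ j)).X := by
  refine hodgeConjectureFor_biproduct_comp_of_twoTransitiveTower_markman hW4 hM6 n p hnp κ h2 hdeg im hA hΨ hp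
    fun m₀ s t s' t' hs ht hs' ht' hst hst' => ?_
  obtain ⟨s₀, t₀, hs₀, ht₀, hst₀, hd⟩ := hD m₀
  exact twoTransitive_of_finrank im (fun m => m < m₀) m₀ (n m₀) (SexticOcticWeil.card_filter_comp_eq_of_finrank (im m₀) (hdeg m₀) h2 τ) hs₀ ht₀ hst₀
    hd s t s' t' hs ht hs' ht' hst hst'

/-! ## §4 The mixed tower: the 2-transitive branch in degree form -/

/-- **THE MIXED TOWER (THE ROOF) IN DEGREE FORM — given ONLY Markman's two theorems.**  As `hodgeConjectureFor_biproduct_comp_of_mixedTower_markman`: one-member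
fields of pairwise coprime degrees in `L`; every tower field `K_{m₀}` (`m₀ ∉ L`) EITHER of prime degree above every live degree (peeled by a prime rotation —
nothing to check) OR having a pair `s₀ ≠ t₀` of `τ`-embeddings with `[L_live ⊔ ℚ(s₀(K_{m₀}) ∪ t₀(K_{m₀})) : ℚ] = [L_live : ℚ] · n_{m₀}(n_{m₀} − 1)`,
`L_live = L(k) ⊔ ⨆ L(K_m)` over the live fields `m ∈ L ∨ (m ∉ L ∧ m < m₀)`.  Then the Hodge conjecture holds for every product of copies `⨁_j A (κ j)`.
`HC_CM` is NOT asserted. [cite: Markman2025SurveySecant, Thm. 1.2] [cite: MoonenZarhin1995Duke, Thm. 2.4] [cite: Lang2002, VI §1 Thm. 1.1, Cor. 1.6 and V §2 Thm. 2.8]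
[cite: DixonMortimer1996, §1.6] -/
theorem hodgeConjectureFor_biproduct_comp_of_mixedTower_markman_of_finrank (hW4 : Markman2025_weilClasses_algebraic_abelianFourfold)
    (hM6 : Markman2025_weilClasses_algebraic_hyperbolicSixfold) (n p : Fin r → ℕ) (L : Finset (Fin r))
    (hnp : ∀ m, (n m = 3 ∧ p m = 1) ∨ (n m = 4 ∧ p m = 1) ∨ (n m = 4 ∧ p m = 2) ∨ (n m = 5 ∧ p m = 2))
    (hcop : ∀ m ∈ L, ∀ m' ∈ L, m ≠ m' → (n m).Coprime (n m')) (hp1 : ∀ m ∈ L, p m = 1)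
    {N : ℕ} (κ : Fin N → Fin (r + 1)) (h2 : Module.finrank ℚ (Kf i₀) = 2) (hdeg : ∀ m : Fin r, Module.finrank ℚ (Kf (is m)) = 2 * n m)
    (im : ∀ m : Fin r, Kf i₀ →+* Kf (is m)) (hA : ∀ j, IsCMTypeRealisation (Φ j) (A j) (ι j) (θ j)) (hΨ : ∀ σ : Kf i₀ →+* ℂ, σ ∈ (Φ 0).1 ↔ σ = τ)
    (hp : ∀ m : Fin r, (Finset.univ.filter fun s : Kf (is m) →+* ℂ => s.comp (im m) = τ ∧ s ∈ (Φ m.succ).1).card = p m)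
    (hmix : ∀ m₀, m₀ ∉ L →
      ((n m₀).Prime ∧ ∀ m : Fin r, (m ∈ L ∨ (m ∉ L ∧ m < m₀)) → n m < n m₀) ∨
      ∃ s₀ t₀ : Kf (is m₀) →+* ℂ, s₀.comp (im m₀) = τ ∧ t₀.comp (im m₀) = τ ∧ s₀ ≠ t₀ ∧
        Module.finrank ℚ ↥((normalClosure ℚ (Kf i₀) ℂ ⊔ ⨆ m : {m : Fin r // m ∈ L ∨ (m ∉ L ∧ m < m₀)}, normalClosure ℚ (Kf (is m.1)) ℂ) ⊔
            adjoin ℚ (Set.range s₀ ∪ Set.range t₀)) =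
          Module.finrank ℚ ↥(normalClosure ℚ (Kf i₀) ℂ ⊔ ⨆ m : {m : Fin r // m ∈ L ∨ (m ∉ L ∧ m < m₀)}, normalClosure ℚ (Kf (is m.1)) ℂ) *
            (n m₀ * (n m₀ - 1))) :
    HodgeConjectureFor (⨁ fun j => A (κ j)).dim (⨁ fun j => A (κ j)).X := by
  refine hodgeConjectureFor_biproduct_comp_of_mixedTower_markman hW4 hM6 n p L hnp hcop hp1 κ h2 hdeg im hA hΨ hp fun m₀ hm₀ => ?_
  rcases hmix m₀ hm₀ with h | ⟨s₀, t₀, hs₀, ht₀, hst₀, hd⟩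
  · exact Or.inl h
  · exact Or.inr fun s t s' t' hs ht hs' ht' hst hst' =>
      twoTransitive_of_finrank im (fun m => m ∈ L ∨ (m ∉ L ∧ m < m₀)) m₀ (n m₀) (SexticOcticWeil.card_filter_comp_eq_of_finrank (im m₀) (hdeg m₀) h2 τ)
        hs₀ ht₀ hst₀ hd s t s' t' hs ht hs' ht' hst hst'

end Summit.HodgeConjecture.CorCM.MultiFieldWeil

end
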